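import Literature.MathematicalPhysics.QuantumFieldTheory.CubicalChainsPoincare
import HarnessLib

/-!
# Integer 1-chains on boxes of `ℤ^d`: closed currents are boundaries of 2-chains inside the box,
# with the `ℓ¹ → ℓ^∞` bound

Support file for the Coulomb-gas analysis of four-dimensional `U(1)` lattice gauge theory (proof
programme of the named fact
`Literature.MathematicalPhysics.QuantumFieldTheory.FrohlichSpencerU1PerimeterLawD4` and of its
corollary `Literature.Barriers.QuantumFields.AbelianDeconfinementD4`): the degree-one case of
Fröhlich–Spencer's support-controlled Poincaré lemma (FS82 §2.3, Lemma 1, p. 421):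

> *Let `α` be a `k`-form with values in `K` (`= ℤ, ℝ, ℂ`) such that `δα = 0`. Then there exists a
> `(k+1)`-form `β` with values in `K` such that `δβ = α`. Moreover `β` can be chosen such that
> `supp β` is contained in the smallest hypercube `Ω_α` containing `supp α`, and
> `max |β(c_{k+1})| ≤ ∑' |α(c_k)|`.*

It is used in degree one at FS82 (2.56) (every closed current density `ρ` of a 1-ensemble is
`ρ = δμ_ρ` with `μ_ρ` a 2-form supported in the hypercube `Ω_ρ`), and the bound
`max |μ_ρ| ≤ ‖ρ‖₁` is (2.84), feeding the perimeter estimate (2.82)–(2.88). The companion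
`CubicalChainsPoincare.lean` proves the degree-two statement (closed 2-chains in a box are
boundaries of 3-chains in the box) by sweeping the coordinate directions; the present file runs the
same sweep one degree lower, in the same CHAIN language (`LatticeChain.bd₂`, `LatticeChain.IsAlt₂`),
and additionally carries the `ℓ¹ → ℓ^∞` bound through the induction. Everything is proved; no
named fact is introduced.

* `bd₁ ρ y = ∑_k (ρ (y - e_k) k - ρ y k)` (the boundary of a 1-chain = minus the lattice divergence
  at the site `y`), `bd₁_bd₂ : bd₁ (bd₂ M) = 0` for alternating `M`.
* The sweep in direction `ℓ` down to the floor `a ℓ` of the box `[a, b]`: `colAbove₁` (column sums),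
  the prism `sweepH₁` (an alternating 2-chain on the plaquettes containing `ℓ`), the floor
  projection `sweepπ₁`, and the homotopy formula `eq_bd₂_sweepH₁_add_sweepπ₁ : ρ = ∂(hρ) + πρ` for
  closed `ρ` supported in the box; `bd₁_sweepπ₁` (the projection is closed).
* The bounds `abs_sweepH₁_le` (`|hρ| ≤ ‖ρ‖₁`) and `sum_abs_sweepπ₁_le` (`‖πρ‖₁ ≤ ‖ρ‖₁`), with
  `‖ρ‖₁ = ∑_{p ∈ T} |ρ p|` for any finite set `T` of links containing the support of `ρ`.
* `exists_bd₂_eq_of_bd₁_eq_zero` (**closed 1-chains in a box are boundaries of 2-chains in the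
  box, with the sup bound**): an integer 1-chain `ρ` with `bd₁ ρ = 0` whose links `(y, k)` lie in
  the box `[a, b]` (`a ≤ y`, `y + e_k ≤ b`) is `bd₂ M` for an alternating 2-chain `M` all of whose
  plaquettes lie in the box, with `|M y j k| ≤ ∑_{p ∈ T} |ρ p|` for every plaquette.

## References

* J. Fröhlich, T. Spencer, Comm. Math. Phys. 83 (1982) 411–454, §2.3 Lemma 1 (p. 421), §2.7
  (2.56), §2.10 (2.82), (2.84). [FrohlichSpencerCMP1982]
-/

noncomputable section

open Finset Function Literature.Probability.LatticeModels

namespace Literature.MathematicalPhysics.QuantumFieldTheory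

namespace LatticeChain

open LatticeForm (e)

variable {d : ℕ}

/-! ### The boundary of a 1-chain -/

/-- **The boundary of a 1-chain**: the coefficient `∑_k (ρ (y - e_k) k - ρ y k)` of the site `y`
(minus the lattice divergence of the current `ρ` at `y`). [folklore] -/
def bd₁ (ρ : Site d → Fin d → ℤ) : Site d → ℤ :=
  fun y => ∑ k, (ρ (y - e k) k - ρ y k)

/-- `bd₁` of a difference. [folklore] -/
theorem bd₁_sub (ρ ρ' : Site d → Fin d → ℤ) : bd₁ (ρ - ρ') = bd₁ ρ - bd₁ ρ' := by
  funext y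
  simp only [bd₁, Pi.sub_apply, ← Finset.sum_sub_distrib]
  exact Finset.sum_congr rfl fun j _ => by ring

/-- `bd₂` is additive. [folklore] -/
theorem bd₂_add (M M' : Site d → Fin d → Fin d → ℤ) : bd₂ (M + M') = bd₂ M + bd₂ M' := by
  funext y k
  simp only [bd₂, Pi.add_apply, ← Finset.sum_add_distrib]
  exact Finset.sum_congr rfl fun j _ => by ring

/-- `bd₂ 0 = 0`. [folklore] -/
@[simp] theorem bd₂_zero : bd₂ (0 : Site d → Fin d → Fin d → ℤ) = 0 := by
  funext y k; simp [bd₂]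

/-- The zero 2-chain is alternating. [folklore] -/
theorem isAlt₂_zero : IsAlt₂ (0 : Site d → Fin d → Fin d → ℤ) := fun _ _ _ => by simp

/-- Sums of alternating 2-chains are alternating. [folklore] -/
theorem IsAlt₂.add {M M' : Site d → Fin d → Fin d → ℤ} (h : IsAlt₂ M) (h' : IsAlt₂ M') :
    IsAlt₂ (M + M') := fun y i j => by
  simp only [Pi.add_apply]; rw [h y i j, h' y i j]; ring

/-- A double sum `∑_k ∑ⱼ M (f j k) j k` with `(j,k)`-symmetric sites `f` vanishes for `M`
alternating. [folklore] -/
theorem sum_sum_eq_zero_of_symm₂ {M : Site d → Fin d → Fin d → ℤ} (h : IsAlt₂ M)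
    (f : Fin d → Fin d → Site d) (hf : ∀ j k, f j k = f k j) :
    ∑ k, ∑ j, M (f j k) j k = 0 := by
  have hs : ∑ k, ∑ j, M (f j k) j k = -∑ k, ∑ j, M (f j k) j k := by
    conv_lhs => rw [Finset.sum_comm]
    simp only [← Finset.sum_neg_distrib]
    refine Finset.sum_congr rfl fun j _ => Finset.sum_congr rfl fun k _ => ?_
    rw [hf k j, h (f j k) j k, neg_neg]
  omega

/-- **`∂∂ = 0` in degree one**: the boundary of the boundary of an alternating 2-chain vanishes.
[folklore] -/
theorem bd₁_bd₂ {M : Site d → Fin d → Fin d → ℤ} (h : IsAlt₂ M) : bd₁ (bd₂ M) = 0 := by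
  funext y
  simp only [bd₁, bd₂, Pi.zero_apply, Finset.sum_sub_distrib]
  have h1 := sum_sum_eq_zero_of_symm₂ h (fun j k => y - e k - e j)
    (fun j k => by rw [sub_sub, sub_sub, add_comm])
  have h2 := sum_sum_eq_zero_of_symm₂ h (fun _ _ => y) (fun _ _ => rfl)
  have h3 : ∑ k, ∑ j, M (y - e k) j k = -∑ k, ∑ j, M (y - e j) j k := by
    conv_lhs => rw [Finset.sum_comm]
    simp only [← Finset.sum_neg_distrib]
    refine Finset.sum_congr rfl fun j _ => Finset.sum_congr rfl fun k _ => ?_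
    rw [h (y - e k) j k, neg_neg]
  omega

/-- The box condition for a link, coordinatewise. [folklore] -/
theorem inBox₁_iff {a b y : Site d} {k : Fin d} :
    (a ≤ y ∧ y + e k ≤ b) ↔ ∀ m, a m ≤ y m ∧ y m + (if m = k then 1 else 0) ≤ b m := by
  simp only [Pi.le_def, ← forall_and]
  refine forall_congr' fun m => ?_
  rw [add_e_apply]

/-! ### The sweep in one direction, degree one -/

section Sweep

variable (a b : Site d) (ℓ : Fin d) (ρ : Site d → Fin d → ℤ)

/-- The column sum of `ρ(·, k)` strictly above `z` in direction `ℓ` (up to the top `b ℓ` of the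
box), cut off below the floor `a ℓ`: the coefficient of the plaquette `(z; ℓ, k)` in the prism of
`ρ`. [folklore] -/
def colAbove₁ (z : Site d) (k : Fin d) : ℤ :=
  if a ℓ ≤ z ℓ then ∑ s ∈ Finset.Ioc (z ℓ) (b ℓ), ρ (update z ℓ s) k else 0

/-- **The prism (homotopy) operator of the sweep in direction `ℓ`, degree one**: the alternating
2-chain stacking, below every link `(y, k)` with `k ≠ ℓ`, the plaquettes `(z; ℓ, k)` from the floor
`a ℓ` up to the link. [folklore] -/
def sweepH₁ (z : Site d) (i k : Fin d) : ℤ :=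
  (if i = ℓ then colAbove₁ a b ℓ ρ z k else 0) - (if k = ℓ then colAbove₁ a b ℓ ρ z i else 0)

/-- **The floor projection of the sweep in direction `ℓ`, degree one**: the links not in direction
`ℓ`, summed along their column and placed on the floor `y ℓ = a ℓ`. [folklore] -/
def sweepπ₁ (y : Site d) (k : Fin d) : ℤ :=
  if k ≠ ℓ ∧ y ℓ = a ℓ then ∑ s ∈ Finset.Icc (a ℓ) (b ℓ), ρ (update y ℓ s) k else 0

variable {a b ℓ ρ}

/-! #### Support consequences -/

/-- Below the floor there is nothing. [folklore] -/
theorem eq_zero_of_apply_lt₁ (hsupp : ∀ y k, ρ y k ≠ 0 → a ≤ y ∧ y + e k ≤ b) {y : Site d}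
    (hy : y ℓ < a ℓ) (k : Fin d) : ρ y k = 0 := by
  by_contra hne
  have := (inBox₁_iff.1 (hsupp y k hne) ℓ).1
  omega

/-- Above the top there is nothing. [folklore] -/
theorem eq_zero_of_lt_apply₁ (hsupp : ∀ y k, ρ y k ≠ 0 → a ≤ y ∧ y + e k ≤ b) {y : Site d}
    (hy : b ℓ < y ℓ) (k : Fin d) : ρ y k = 0 := by
  by_contra hne
  have := (inBox₁_iff.1 (hsupp y k hne) ℓ).2
  split_ifs at this <;> omega

/-- A link in direction `ℓ` based at height `b ℓ` sticks out of the box. [folklore] -/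
theorem eq_zero_top₁ (hsupp : ∀ y k, ρ y k ≠ 0 → a ≤ y ∧ y + e k ≤ b) {y : Site d}
    (hy : b ℓ ≤ y ℓ) : ρ y ℓ = 0 := by
  by_contra hne
  have := (inBox₁_iff.1 (hsupp y ℓ hne) ℓ).2
  simp only [if_true] at this
  omega

/-! #### Alternation and supports of the sweep operators -/

/-- The prism is alternating. [folklore] -/
theorem isAlt₂_sweepH₁ : IsAlt₂ (sweepH₁ a b ℓ ρ) := by
  intro y i k
  simp only [sweepH₁]
  ring

/-- The floor projection has no component in the swept direction. [folklore] -/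
theorem sweepπ₁_eq_zero_self (y : Site d) : sweepπ₁ a b ℓ ρ y ℓ = 0 := by
  simp [sweepπ₁]

/-- The floor projection only has components that `ρ` has. [folklore] -/
theorem sweepπ₁_eq_zero_of_forall {y : Site d} {k : Fin d} (h : ∀ s, ρ (update y ℓ s) k = 0) :
    sweepπ₁ a b ℓ ρ y k = 0 := by
  unfold sweepπ₁
  split_ifs
  · exact Finset.sum_eq_zero fun s _ => h s
  · rfl

/-- Support of the floor projection: its links lie in the box if those of `ρ` do. [folklore] -/
theorem sweepπ₁_supp (hsupp : ∀ y k, ρ y k ≠ 0 → a ≤ y ∧ y + e k ≤ b) {y : Site d} {k : Fin d}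
    (h : sweepπ₁ a b ℓ ρ y k ≠ 0) : a ≤ y ∧ y + e k ≤ b := by
  unfold sweepπ₁ at h
  split_ifs at h with hc
  · obtain ⟨hk, hy⟩ := hc
    obtain ⟨s, hs, hne⟩ := Finset.exists_ne_zero_of_sum_ne_zero h
    have H := inBox₁_iff.1 (hsupp _ k hne)
    rw [Finset.mem_Icc] at hs
    refine inBox₁_iff.2 fun m => ?_
    have Hm := H m
    by_cases hm : m = ℓ
    · subst hm
      rw [update_self, if_neg (Ne.symm hk)] at Hm
      rw [if_neg (Ne.symm hk), hy]
      omega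
    · rwa [update_of_ne hm] at Hm
  · exact absurd rfl h

/-- Support of a non-zero column sum: the plaquette `(z; ℓ, k)` lies in the box. [folklore] -/
theorem colAbove₁_supp (hsupp : ∀ y k, ρ y k ≠ 0 → a ≤ y ∧ y + e k ≤ b) {z : Site d} {k : Fin d}
    (hc : colAbove₁ a b ℓ ρ z k ≠ 0) : a ≤ z ∧ z + e ℓ + e k ≤ b := by
  unfold colAbove₁ at hc
  split_ifs at hc with hz
  · obtain ⟨s, hs, hne⟩ := Finset.exists_ne_zero_of_sum_ne_zero hc
    have H := inBox₁_iff.1 (hsupp _ k hne)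
    rw [Finset.mem_Ioc] at hs
    have Hℓ := H ℓ
    rw [update_self] at Hℓ
    refine inBox₂_iff.2 fun m => ?_
    have Hm := H m
    by_cases hm : m = ℓ
    · subst hm
      rw [if_pos rfl]
      split_ifs at Hℓ <;> omega
    · rw [update_of_ne hm] at Hm
      rw [if_neg hm]
      omega
  · exact absurd rfl hc

/-- A non-zero prism coefficient comes from one of its two column sums. [folklore] -/
theorem sweepH₁_ne_zero_cases {z : Site d} {i k : Fin d} (h : sweepH₁ a b ℓ ρ z i k ≠ 0) :
    (i = ℓ ∧ k ≠ ℓ ∧ colAbove₁ a b ℓ ρ z k ≠ 0) ∨ (k = ℓ ∧ i ≠ ℓ ∧ colAbove₁ a b ℓ ρ z i ≠ 0) := by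
  unfold sweepH₁ at h
  by_cases hi : i = ℓ
  · by_cases hk : k = ℓ
    · subst hi; subst hk; simp at h
    · left
      refine ⟨hi, hk, ?_⟩
      rw [if_pos hi, if_neg hk, sub_zero] at h
      exact h
  · by_cases hk : k = ℓ
    · right
      refine ⟨hk, hi, ?_⟩
      rw [if_neg hi, if_pos hk, zero_sub, neg_ne_zero] at h
      exact h
    · rw [if_neg hi, if_neg hk, sub_zero] at h
      exact absurd rfl h

/-- Support of the prism: its plaquettes lie in the box if the links of `ρ` do. [folklore] -/
theorem sweepH₁_supp (hsupp : ∀ y k, ρ y k ≠ 0 → a ≤ y ∧ y + e k ≤ b) {z : Site d} {i k : Fin d}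
    (h : sweepH₁ a b ℓ ρ z i k ≠ 0) : a ≤ z ∧ z + e i + e k ≤ b := by
  rcases sweepH₁_ne_zero_cases h with ⟨hi, -, hc⟩ | ⟨hk, -, hc⟩
  · rw [hi]; exact colAbove₁_supp hsupp hc
  · obtain ⟨h1, h2⟩ := colAbove₁_supp hsupp hc
    rw [hk]
    refine ⟨h1, ?_⟩
    have : z + e i + e ℓ = z + e ℓ + e i := by abel
    rw [this]; exact h2

/-- The prism lives on plaquettes containing the swept direction. [folklore] -/
theorem sweepH₁_eq_zero_of_ne {z : Site d} {i k : Fin d} (hi : i ≠ ℓ) (hk : k ≠ ℓ) :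
    sweepH₁ a b ℓ ρ z i k = 0 := by
  simp [sweepH₁, hi, hk]

/-- The directions of the prism: the swept one and a direction of `ρ`. [folklore] -/
theorem sweepH₁_dir {S : Finset (Fin d)} (hS : ∀ y k, ρ y k ≠ 0 → k ∈ S) {z : Site d} {i k : Fin d}
    (h : sweepH₁ a b ℓ ρ z i k ≠ 0) : (i = ℓ ∧ k ∈ S) ∨ (k = ℓ ∧ i ∈ S) := by
  have key : ∀ {k'}, colAbove₁ a b ℓ ρ z k' ≠ 0 → k' ∈ S := by
    intro k' hc
    unfold colAbove₁ at hc
    split_ifs at hc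
    · obtain ⟨s, -, hne⟩ := Finset.exists_ne_zero_of_sum_ne_zero hc
      exact hS _ _ hne
    · exact absurd rfl hc
  rcases sweepH₁_ne_zero_cases h with ⟨hi, -, hc⟩ | ⟨hk, -, hc⟩
  · exact Or.inl ⟨hi, key hc⟩
  · exact Or.inr ⟨hk, key hc⟩

/-! #### The homotopy formula for closed 1-chains -/

/-- The boundary of the prism on a link not in direction `ℓ`: the difference of the column sums
above `y - e_ℓ` and above `y`. [folklore] -/
theorem bd₂_sweepH₁_of_ne {y : Site d} {k : Fin d} (hk : k ≠ ℓ) :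
    bd₂ (sweepH₁ a b ℓ ρ) y k = colAbove₁ a b ℓ ρ (y - e ℓ) k - colAbove₁ a b ℓ ρ y k := by
  simp only [bd₂, sweepH₁, if_neg hk, sub_zero]
  rw [Finset.sum_sub_distrib, Finset.sum_ite_eq' Finset.univ ℓ, Finset.sum_ite_eq' Finset.univ ℓ]
  simp

/-- The boundary of the prism on a link in direction `ℓ`: minus the sum over the other directions
`j` of the differences of the side column sums. [folklore] -/
theorem bd₂_sweepH₁_self (y : Site d) :
    bd₂ (sweepH₁ a b ℓ ρ) y ℓ =
      -∑ j ∈ Finset.univ.erase ℓ, (colAbove₁ a b ℓ ρ (y - e j) j - colAbove₁ a b ℓ ρ y j) := by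
  simp only [bd₂, sweepH₁, if_true]
  set g : Fin d → ℤ := fun j => colAbove₁ a b ℓ ρ (y - e j) j - colAbove₁ a b ℓ ρ y j with hg
  have h1 : ∀ j, ((if j = ℓ then colAbove₁ a b ℓ ρ (y - e j) ℓ else 0) - colAbove₁ a b ℓ ρ (y - e j) j -
      ((if j = ℓ then colAbove₁ a b ℓ ρ y ℓ else 0) - colAbove₁ a b ℓ ρ y j)) =
      (if j = ℓ then g ℓ else 0) - g j := by
    intro j
    by_cases hj : j = ℓ
    · subst hj; simp [hg]
    · simp only [if_neg hj, hg]; ring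
  rw [Finset.sum_congr rfl fun j _ => h1 j, Finset.sum_sub_distrib, Finset.sum_ite_eq' Finset.univ ℓ,
    if_pos (Finset.mem_univ ℓ), ← Finset.add_sum_erase Finset.univ g (Finset.mem_univ ℓ)]
  ring

/-- **Closedness, summed along a column**: for a closed 1-chain in the box, the coefficient of a
link `(y, ℓ)` in the swept direction (base point not below the floor) equals minus the sum over
`j ≠ ℓ` of the differences of the column sums of `ρ(·, j)` above `y - eⱼ` and above `y` (the
`ℓ`-terms of `∑_{s > y_ℓ} (∂ρ)(y|s) = 0` telescope to `ρ y ℓ`). [folklore] -/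
theorem apply_self_eq_of_closed (hcl : bd₁ ρ = 0)
    (hsupp : ∀ y k, ρ y k ≠ 0 → a ≤ y ∧ y + e k ≤ b) {y : Site d} (hy : a ℓ ≤ y ℓ) :
    ρ y ℓ = -∑ j ∈ Finset.univ.erase ℓ, (colAbove₁ a b ℓ ρ (y - e j) j - colAbove₁ a b ℓ ρ y j) := by
  -- the vanishing column sum of the boundary
  have h0 : ∑ s ∈ Finset.Ioc (y ℓ) (b ℓ), ∑ j, (ρ (update y ℓ s - e j) j - ρ (update y ℓ s) j) = 0 :=
    Finset.sum_eq_zero fun s _ => by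
      have := congrFun hcl (update y ℓ s)
      simpa only [bd₁, Pi.zero_apply] using this
  rw [Finset.sum_comm, ← Finset.add_sum_erase Finset.univ _ (Finset.mem_univ ℓ)] at h0
  -- the `ℓ`-term telescopes to `ρ y ℓ`
  have hℓ : ∑ s ∈ Finset.Ioc (y ℓ) (b ℓ), (ρ (update y ℓ s - e ℓ) ℓ - ρ (update y ℓ s) ℓ) = ρ y ℓ := by
    rcases le_or_gt (y ℓ) (b ℓ) with hyb | hyb
    · have ht := sum_Ioc_telescope (fun s => ρ (update y ℓ s) ℓ) hyb
      have hrw : ∀ s, ρ (update y ℓ s - e ℓ) ℓ = ρ (update y ℓ (s - 1)) ℓ := fun s => by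
        rw [update_pred]
      simp_rw [hrw]
      rw [ht, update_eq_self, eq_zero_top₁ hsupp (y := update y ℓ (b ℓ)) (by rw [update_self]),
        sub_zero]
    · rw [Finset.Ioc_eq_empty (by omega), Finset.sum_empty, eq_zero_top₁ hsupp hyb.le]
  -- the other terms are differences of column sums
  have hj : ∀ j ∈ Finset.univ.erase ℓ,
      ∑ s ∈ Finset.Ioc (y ℓ) (b ℓ), (ρ (update y ℓ s - e j) j - ρ (update y ℓ s) j) =
        colAbove₁ a b ℓ ρ (y - e j) j - colAbove₁ a b ℓ ρ y j := by
    intro j hj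
    have hjℓ : j ≠ ℓ := Finset.ne_of_mem_erase hj
    have hyj : (y - e j) ℓ = y ℓ := by rw [sub_e_apply, if_neg (Ne.symm hjℓ), sub_zero]
    simp only [colAbove₁, hyj, if_pos hy, Finset.sum_sub_distrib]
    congr 1
    exact Finset.sum_congr rfl fun s _ => by rw [update_sub_e_of_ne y hjℓ]
  rw [hℓ, Finset.sum_congr rfl hj] at h0
  omega

/-- **The homotopy formula of the sweep for closed 1-chains**: a closed 1-chain whose links lie in
the box `[a, b]` is the boundary of its prism plus its floor projection, `ρ = ∂(hρ) + πρ`.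
[folklore] -/
theorem eq_bd₂_sweepH₁_add_sweepπ₁ (hcl : bd₁ ρ = 0)
    (hsupp : ∀ y k, ρ y k ≠ 0 → a ≤ y ∧ y + e k ≤ b) :
    ρ = bd₂ (sweepH₁ a b ℓ ρ) + sweepπ₁ a b ℓ ρ := by
  funext y k
  simp only [Pi.add_apply]
  by_cases hk : k = ℓ
  · subst hk
    rw [sweepπ₁_eq_zero_self, add_zero, bd₂_sweepH₁_self]
    rcases le_or_gt (a k) (y k) with hy | hy
    · exact apply_self_eq_of_closed hcl hsupp hy
    · rw [eq_zero_of_apply_lt₁ hsupp hy]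
      symm
      rw [neg_eq_zero]
      refine Finset.sum_eq_zero fun j hj => ?_
      have hjℓ : j ≠ k := Finset.ne_of_mem_erase hj
      have hyj : (y - e j) k = y k := by rw [sub_e_apply, if_neg (Ne.symm hjℓ), sub_zero]
      simp only [colAbove₁, hyj, if_neg (not_le.2 hy), sub_self]
  · -- links not in direction `ℓ`
    rw [bd₂_sweepH₁_of_ne hk]
    simp only [colAbove₁, sweepπ₁, sub_e_apply, if_true, update_sub_e_self, Ne, hk,
      not_false_eq_true, true_and]
    rcases lt_trichotomy (y ℓ) (a ℓ) with hy | hy | hy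
    · -- below the floor
      rw [if_neg (by omega), if_neg (by omega), if_neg (by omega), eq_zero_of_apply_lt₁ hsupp hy]
      simp
    · -- on the floor
      rw [if_neg (by omega), if_pos hy.ge, if_pos hy, zero_sub]
      rcases le_or_gt (a ℓ) (b ℓ) with hab | hab
      · rw [sum_Icc_eq_add_sum_Ioc hab, ← hy, update_eq_self]
        ring
      · rw [Finset.Ioc_eq_empty (by omega), Finset.Icc_eq_empty (by omega), Finset.sum_empty,
          eq_zero_of_lt_apply₁ (ℓ := ℓ) hsupp (by omega)]
        simp
    · -- above the floor
      rw [if_pos (by omega), if_pos hy.le, if_neg (by omega), add_zero, Ioc_pred_eq_Icc]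
      rcases le_or_gt (y ℓ) (b ℓ) with hyb | hyb
      · rw [sum_Icc_eq_add_sum_Ioc hyb, update_eq_self]
        ring
      · rw [Finset.Ioc_eq_empty (by omega), Finset.Icc_eq_empty (by omega), Finset.sum_empty,
          eq_zero_of_lt_apply₁ hsupp hyb]
        simp

/-- The floor projection of a closed 1-chain is closed (`∂πρ = ∂ρ - ∂∂hρ = 0`). [folklore] -/
theorem bd₁_sweepπ₁ (hcl : bd₁ ρ = 0) (hsupp : ∀ y k, ρ y k ≠ 0 → a ≤ y ∧ y + e k ≤ b) :
    bd₁ (sweepπ₁ a b ℓ ρ) = 0 := by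
  have h := eq_bd₂_sweepH₁_add_sweepπ₁ (ℓ := ℓ) hcl hsupp
  have h' : sweepπ₁ a b ℓ ρ = ρ - bd₂ (sweepH₁ a b ℓ ρ) := by
    rw [eq_sub_iff_add_eq, add_comm, ← h]
  rw [h', bd₁_sub, hcl, bd₁_bd₂ isAlt₂_sweepH₁, sub_zero]

/-! #### The `ℓ¹ → ℓ^∞` bounds -/

/-- A column sum is bounded by the `ℓ¹` norm of `ρ` (over any finite set of links containing its
support). [cite: FrohlichSpencerCMP1982, §2.3 Lemma 1 (sup bound)] -/
theorem abs_colAbove₁_le {T : Finset (Site d × Fin d)} (hT : ∀ y k, ρ y k ≠ 0 → (y, k) ∈ T)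
    (z : Site d) (k : Fin d) : |colAbove₁ a b ℓ ρ z k| ≤ ∑ p ∈ T, |ρ p.1 p.2| := by
  classical
  unfold colAbove₁
  split_ifs
  · refine (Finset.abs_sum_le_sum_abs _ _).trans ?_
    -- drop the zero terms, then reindex injectively into `T`
    rw [← Finset.sum_filter_ne_zero (Finset.Ioc (z ℓ) (b ℓ))]
    set F := (Finset.Ioc (z ℓ) (b ℓ)).filter fun s => |ρ (update z ℓ s) k| ≠ 0 with hF
    have hinj : Set.InjOn (fun s : ℤ => (update z ℓ s, k)) F := by
      intro s _ s' _ hss'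
      have := congrArg (fun p : Site d × Fin d => p.1 ℓ) hss'
      simpa using this
    have himg : F.image (fun s : ℤ => (update z ℓ s, k)) ⊆ T := by
      intro p hp
      obtain ⟨s, hs, rfl⟩ := Finset.mem_image.1 hp
      have hs' := (Finset.mem_filter.1 hs).2
      exact hT _ _ (abs_ne_zero.1 hs')
    calc ∑ s ∈ F, |ρ (update z ℓ s) k|
        = ∑ p ∈ F.image (fun s : ℤ => (update z ℓ s, k)), |ρ p.1 p.2| := by
          rw [Finset.sum_image hinj]
      _ ≤ ∑ p ∈ T, |ρ p.1 p.2| :=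
          Finset.sum_le_sum_of_subset_of_nonneg himg fun _ _ _ => abs_nonneg _
  · simp only [abs_zero]
    exact Finset.sum_nonneg fun _ _ => abs_nonneg _

/-- **The prism is bounded by `‖ρ‖₁`.** [cite: FrohlichSpencerCMP1982, §2.3 Lemma 1 (sup bound)] -/
theorem abs_sweepH₁_le {T : Finset (Site d × Fin d)} (hT : ∀ y k, ρ y k ≠ 0 → (y, k) ∈ T)
    (z : Site d) (i k : Fin d) : |sweepH₁ a b ℓ ρ z i k| ≤ ∑ p ∈ T, |ρ p.1 p.2| := by
  have h0 : 0 ≤ ∑ p ∈ T, |ρ p.1 p.2| := Finset.sum_nonneg fun _ _ => abs_nonneg _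
  unfold sweepH₁
  by_cases hi : i = ℓ
  · by_cases hk : k = ℓ
    · subst hi; subst hk; simpa using h0
    · rw [if_pos hi, if_neg hk, sub_zero]; exact abs_colAbove₁_le hT z k
  · by_cases hk : k = ℓ
    · rw [if_neg hi, if_pos hk, zero_sub, abs_neg]; exact abs_colAbove₁_le hT z i
    · rw [if_neg hi, if_neg hk, sub_zero]; simpa using h0

/-- The map sending a link to its copy on the floor. [folklore] -/
def toFloor (a : Site d) (ℓ : Fin d) (p : Site d × Fin d) : Site d × Fin d := (update p.1 ℓ (a ℓ), p.2)

/-- The floor projection is supported on the floor copies of the links of `ρ`. [folklore] -/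
theorem sweepπ₁_mem_image [DecidableEq (Site d × Fin d)] {T : Finset (Site d × Fin d)}
    (hT : ∀ y k, ρ y k ≠ 0 → (y, k) ∈ T) {y : Site d} {k : Fin d} (h : sweepπ₁ a b ℓ ρ y k ≠ 0) :
    (y, k) ∈ T.image (toFloor a ℓ) := by
  unfold sweepπ₁ at h
  split_ifs at h with hc
  · obtain ⟨s, -, hne⟩ := Finset.exists_ne_zero_of_sum_ne_zero h
    refine Finset.mem_image.2 ⟨(update y ℓ s, k), hT _ _ hne, ?_⟩
    simp only [toFloor, update_idem, ← hc.2, update_eq_self]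
  · exact absurd rfl h

/-- **`‖πρ‖₁ ≤ ‖ρ‖₁`**: the floor projection does not increase the `ℓ¹` norm (sum over the floor
copies of the links versus sum over the links, fibrewise). [cite: FrohlichSpencerCMP1982, §2.3 Lemma 1 (sup bound)] -/
theorem sum_abs_sweepπ₁_le [DecidableEq (Site d × Fin d)] {T : Finset (Site d × Fin d)}
    (hT : ∀ y k, ρ y k ≠ 0 → (y, k) ∈ T) :
    ∑ q ∈ T.image (toFloor a ℓ), |sweepπ₁ a b ℓ ρ q.1 q.2| ≤ ∑ p ∈ T, |ρ p.1 p.2| := by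
  classical
  rw [← Finset.sum_fiberwise_of_maps_to (g := toFloor a ℓ) (t := T.image (toFloor a ℓ))
    (fun p hp => Finset.mem_image_of_mem _ hp) (fun p => |ρ p.1 p.2|)]
  refine Finset.sum_le_sum fun q hq => ?_
  -- `|πρ(q)| ≤ ∑_{p ∈ T, toFloor p = q} |ρ p|`
  have hfl : q.1 ℓ = a ℓ := by
    obtain ⟨p, -, rfl⟩ := Finset.mem_image.1 hq
    simp [toFloor]
  unfold sweepπ₁
  split_ifs with hc
  · refine (Finset.abs_sum_le_sum_abs _ _).trans ?_
    rw [← Finset.sum_filter_ne_zero (Finset.Icc (a ℓ) (b ℓ))]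
    set F := (Finset.Icc (a ℓ) (b ℓ)).filter fun s => |ρ (update q.1 ℓ s) q.2| ≠ 0 with hF
    have hinj : Set.InjOn (fun s : ℤ => (update q.1 ℓ s, q.2)) F := by
      intro s _ s' _ hss'
      have := congrArg (fun p : Site d × Fin d => p.1 ℓ) hss'
      simpa using this
    have himg : F.image (fun s : ℤ => (update q.1 ℓ s, q.2)) ⊆ T.filter fun p => toFloor a ℓ p = q := by
      intro p hp
      obtain ⟨s, hs, rfl⟩ := Finset.mem_image.1 hp
      have hs' := (Finset.mem_filter.1 hs).2
      refine Finset.mem_filter.2 ⟨hT _ _ (abs_ne_zero.1 hs'), ?_⟩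
      simp only [toFloor, update_idem, ← hfl, update_eq_self]
    calc ∑ s ∈ F, |ρ (update q.1 ℓ s) q.2|
        = ∑ p ∈ F.image (fun s : ℤ => (update q.1 ℓ s, q.2)), |ρ p.1 p.2| := by
          rw [Finset.sum_image hinj]
      _ ≤ ∑ p ∈ T.filter (fun p => toFloor a ℓ p = q), |ρ p.1 p.2| :=
          Finset.sum_le_sum_of_subset_of_nonneg himg fun _ _ _ => abs_nonneg _
  · simp only [abs_zero]
    exact Finset.sum_nonneg fun _ _ => abs_nonneg _

end Sweep

/-! ### Closed 1-chains in a box are boundaries of 2-chains in the box, with the sup bound -/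

/-- Induction over the set of directions carried by the chain. [folklore] -/
theorem exists_bd₂_eq_aux (a b : Site d) (S : Finset (Fin d)) :
    ∀ ρ : Site d → Fin d → ℤ, bd₁ ρ = 0 →
      (∀ y k, ρ y k ≠ 0 → a ≤ y ∧ y + e k ≤ b) → (∀ y k, ρ y k ≠ 0 → k ∈ S) →
      ∀ T : Finset (Site d × Fin d), (∀ y k, ρ y k ≠ 0 → (y, k) ∈ T) →
        ∃ M : Site d → Fin d → Fin d → ℤ, IsAlt₂ M ∧ bd₂ M = ρ ∧
          (∀ y j k, M y j k ≠ 0 → a ≤ y ∧ y + e j + e k ≤ b) ∧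
          (∀ y j k, M y j k ≠ 0 → j ∈ S ∧ k ∈ S) ∧
          ∀ y j k, |M y j k| ≤ ∑ p ∈ T, |ρ p.1 p.2| := by
  classical
  induction S using Finset.induction_on with
  | empty =>
    intro ρ _ _ hS T _
    have hρ : ρ = 0 := by
      funext y k
      by_contra hne
      exact Finset.notMem_empty k (hS y k hne)
    refine ⟨0, isAlt₂_zero, ?_, fun y j k h => absurd rfl h, fun y j k h => absurd rfl h, fun y j k => ?_⟩
    · rw [bd₂_zero, hρ]
    · simp only [Pi.zero_apply, abs_zero]
      exact Finset.sum_nonneg fun _ _ => abs_nonneg _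
  | insert ℓ S hℓS ih =>
    intro ρ hcl hsupp hS T hT
    have hdec := eq_bd₂_sweepH₁_add_sweepπ₁ (ℓ := ℓ) hcl hsupp
    have hcl' := bd₁_sweepπ₁ (ℓ := ℓ) hcl hsupp
    have hsupp' : ∀ y k, sweepπ₁ a b ℓ ρ y k ≠ 0 → a ≤ y ∧ y + e k ≤ b :=
      fun y k h => sweepπ₁_supp hsupp h
    have hS' : ∀ y k, sweepπ₁ a b ℓ ρ y k ≠ 0 → k ∈ S := by
      intro y k h
      have hkℓ : k ≠ ℓ := by
        rintro rfl
        exact h (sweepπ₁_eq_zero_self y)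
      have hk : k ∈ insert ℓ S := by
        by_contra hk'
        exact h (sweepπ₁_eq_zero_of_forall fun s => by
          by_contra hne
          exact hk' (hS _ k hne))
      exact (Finset.mem_insert.1 hk).resolve_left hkℓ
    have hT' : ∀ y k, sweepπ₁ a b ℓ ρ y k ≠ 0 → (y, k) ∈ T.image (toFloor a ℓ) :=
      fun y k h => sweepπ₁_mem_image hT h
    obtain ⟨M', hM'alt, hM'bd, hM'supp, hM'dir, hM'le⟩ :=
      ih (sweepπ₁ a b ℓ ρ) hcl' hsupp' hS' (T.image (toFloor a ℓ)) hT'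
    have hπle := sum_abs_sweepπ₁_le (a := a) (b := b) (ℓ := ℓ) hT
    refine ⟨sweepH₁ a b ℓ ρ + M', isAlt₂_sweepH₁.add hM'alt, ?_, ?_, ?_, ?_⟩
    · rw [bd₂_add, hM'bd, ← hdec]
    · intro y j k h
      simp only [Pi.add_apply] at h
      by_cases hH : sweepH₁ a b ℓ ρ y j k = 0
      · rw [hH, zero_add] at h
        exact hM'supp y j k h
      · exact sweepH₁_supp hsupp hH
    · intro y j k h
      simp only [Pi.add_apply] at h
      by_cases hH : sweepH₁ a b ℓ ρ y j k = 0
      · rw [hH, zero_add] at h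
        obtain ⟨hj, hk⟩ := hM'dir y j k h
        exact ⟨Finset.mem_insert_of_mem hj, Finset.mem_insert_of_mem hk⟩
      · rcases sweepH₁_dir hS hH with ⟨hj, hk⟩ | ⟨hk, hj⟩
        · exact ⟨hj ▸ Finset.mem_insert_self _ _, hk⟩
        · exact ⟨hj, hk ▸ Finset.mem_insert_self _ _⟩
    · -- the sup bound: the prism and `M'` live on disjoint sets of plaquettes
      intro y j k
      simp only [Pi.add_apply]
      by_cases hjk : j ≠ ℓ ∧ k ≠ ℓ
      · rw [sweepH₁_eq_zero_of_ne hjk.1 hjk.2, zero_add]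
        exact (hM'le y j k).trans hπle
      · have hM'0 : M' y j k = 0 := by
          by_contra hne
          obtain ⟨hj, hk⟩ := hM'dir y j k hne
          rcases not_and_or.1 hjk with h | h <;> simp only [not_not] at h
          · exact hℓS (h ▸ hj)
          · exact hℓS (h ▸ hk)
        rw [hM'0, add_zero]
        exact abs_sweepH₁_le hT y j k

/-- **Closed 1-chains in a box are boundaries of 2-chains in the box, with the `ℓ¹ → ℓ^∞` bound**
(Fröhlich–Spencer 1982 Lemma 1 in degree one, chain language of `ℤ^d`): an integer 1-chain `ρ`
(a current density) with `∂ρ = 0` all of whose links `(y, k)` lie in the box `[a, b]` (`a ≤ y`,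
`y + e_k ≤ b`) is the boundary `∂M` of an alternating integer 2-chain `M` all of whose plaquettes
lie in the same box, and `max |M| ≤ ‖ρ‖₁ = ∑_{p ∈ T} |ρ p|` for any finite set of links `T`
containing the support of `ρ`. (FS82 use it, dually, at (2.56): `ρ = δμ_ρ` with
`supp μ_ρ ⊆ Ω_ρ`, and at (2.84): `max |μ_ρ| ≤ ‖ρ‖₁`.) Proof: sweep the coordinate directions in
turn (`eq_bd₂_sweepH₁_add_sweepπ₁`), carrying the bounds `|hρ| ≤ ‖ρ‖₁`, `‖πρ‖₁ ≤ ‖ρ‖₁`.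
[cite: FrohlichSpencerCMP1982, §2.3 Lemma 1 p. 421 (Poincaré lemma with supports and sup bound), (2.56), (2.84)] -/
theorem exists_bd₂_eq_of_bd₁_eq_zero (a b : Site d) (ρ : Site d → Fin d → ℤ) (hcl : bd₁ ρ = 0)
    (hsupp : ∀ y k, ρ y k ≠ 0 → a ≤ y ∧ y + e k ≤ b) (T : Finset (Site d × Fin d))
    (hT : ∀ y k, ρ y k ≠ 0 → (y, k) ∈ T) :
    ∃ M : Site d → Fin d → Fin d → ℤ, IsAlt₂ M ∧ bd₂ M = ρ ∧
      (∀ y j k, M y j k ≠ 0 → a ≤ y ∧ y + e j + e k ≤ b) ∧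
      ∀ y j k, |M y j k| ≤ ∑ p ∈ T, |ρ p.1 p.2| := by
  obtain ⟨M, h1, h2, h3, -, h5⟩ :=
    exists_bd₂_eq_aux a b Finset.univ ρ hcl hsupp (fun _ k _ => Finset.mem_univ k) T hT
  exact ⟨M, h1, h2, h3, h5⟩

end LatticeChain

end Literature.MathematicalPhysics.QuantumFieldTheory
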